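import Summits.HubbardSuperconductivity.HubbardSuperconductivity.Theorems.KLProgrammeKLRegimeFlowReadScaleZeroTadpoleBound

/-!
# Route `KLProgramme`, crux K3 — ENGINE (stmt-HubbardSuperconductivity-20437 `KLRegimeEngineV17F2`), row (C) credit path, GAP **G-005**
# «(C)-TADPOLE-NONVANISHING»: THE MATSUBARA BRIDGE — the scale-`0` tadpole `t₀` IS REAL and equals `L⁻²` times the UV Hartree sum

Seat hubbard-kl-k3c5-p1 (g19; Matsubara supplier of G-005, pen (R433)(B)).  The first-order (Hartree) constant of the scale-`0` two-leg
read is `−U·T₀` with `T₀ = Σ_{k=(i,k⃗)} (βL²)⁻²·Ψ⁰((i,k⃗),σ)` (`…FlowReadScaleZeroDiagonalSplit.abs_diagConst_le`'s first-order term;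
`Ψ⁰ = uvSymbolCT … 0 klE0`, `|T₀| ≤ 4` by `norm_scaleZero_tadpole_le_four`), while the landed LOWER bound of G-005's analytic core
(`…Theorems.MatsubaraTadpole.sum_uvTadpole_salmhofer_halfShift_ge`, p1b g18) is stated for the real sum
`Σ_{k⃗} β⁻¹Σᵢ χ₂((ωᵢ²+e_k²)/Λ₀²)·e_k/(ωᵢ²+e_k²)`, `e_k = ε_L(k⃗) − μ`.  This file identifies the two EXACTLY:
* §1 `sum_matsubara_uvSymbolFn_eq_ofReal` — over the symmetric truncated Matsubara set, `Σᵢ Ψ̂(c,Λ;e,ωᵢ) = ((Σᵢ w(ωᵢ,e)·c·e/(ωᵢ²+e²) : ℝ) : ℂ)`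
  (the `±ω` pairing `uvSymbolFn_add_uvSymbolFn_neg_freq` summed via the reflection `Fin.revPerm`, `matsubaraFreq_rev`);
* §2 **`scaleZero_tadpole_eq_ofReal_uvTadpoleSum`** — `Σ_k (βL²)⁻²Ψ⁰(k,σ) = ((L⁻²·Σ_{k⃗} β⁻¹Σᵢ χ₂((ωᵢ²+e_k²)/klE0²)·e_k/(ωᵢ²+e_k²) : ℝ) : ℂ)`,
  hence `(…).im = 0`, `(…).re = L⁻²·(that sum)` (`scaleZero_tadpole_im`, `scaleZero_tadpole_re`), and the monotone transfer
  `scaleZero_tadpole_re_ge_of_le`: any lower bound `B ≤ Σ_{k⃗} …` gives `B/L² ≤ Re T₀`.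
Proofs only; no definitions; nothing here asserts G-005, (C), any stub of 20437, K3 or superconductivity.
References: BGM 2006 §2.1 (2.3)–(2.6) [cite: BenfattoGiulianiMastropietro2006]; Salmhofer 1999 §4.2.4 (4.63) [cite: Salmhofer1999].
-/

noncomputable section

namespace Summit.HubbardSuperconductivity.HubbardSuperconductivity.Theorems.KLRegimeSplit

set_option linter.dupNamespace false -- summit = problem name (single-conjunct summit), D-0017

open Real Finset Complex Literature.MathematicalPhysics.QuantumLattice Literature.Probability.LatticeModels
open Summit.HubbardSuperconductivity.HubbardSuperconductivity.Theorems.EngineV8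

/-! ## §1 The symmetric Matsubara sum of the UV symbol is real -/

/-- **`Σᵢ Ψ̂(e,ωᵢ)` over the symmetric truncated Matsubara set is the REAL number `Σᵢ w(ωᵢ,e)·c·e/(ωᵢ²+e²)`** (`0 < β`): pair `ωᵢ` with
`ω_{rev i} = −ωᵢ`. [cite: BenfattoGiulianiMastropietro2006, §2.1 (2.3)] -/
theorem sum_matsubara_uvSymbolFn_eq_ofReal {β : ℝ} (hβ : 0 < β) (c Λ e : ℝ) (M : ℕ) :
    ∑ i : MatsubaraIdx M, uvSymbolFn c Λ e (matsubaraFreq β M i) =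
      ((∑ i : MatsubaraIdx M, uvWeightFn Λ e (matsubaraFreq β M i) * (c * (e / (matsubaraFreq β M i ^ 2 + e ^ 2))) : ℝ) : ℂ) := by
  have hrev : ∑ i : MatsubaraIdx M, uvSymbolFn c Λ e (matsubaraFreq β M i) =
      ∑ i : MatsubaraIdx M, uvSymbolFn c Λ e (-matsubaraFreq β M i) := by
    refine Fintype.sum_equiv Fin.revPerm _ _ (fun i => ?_)
    rw [Fin.revPerm_apply, matsubaraFreq_rev, neg_neg]
  have hpair : ∀ i : MatsubaraIdx M, uvSymbolFn c Λ e (matsubaraFreq β M i) + uvSymbolFn c Λ e (-matsubaraFreq β M i) =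
      ((uvWeightFn Λ e (matsubaraFreq β M i) * (c * (2 * e / (matsubaraFreq β M i ^ 2 + e ^ 2))) : ℝ) : ℂ) :=
    fun i => uvSymbolFn_add_uvSymbolFn_neg_freq c Λ e (matsubaraFreq_ne_zero hβ.ne' i)
  have h2 : (2 : ℂ) * ∑ i : MatsubaraIdx M, uvSymbolFn c Λ e (matsubaraFreq β M i) =
      ∑ i : MatsubaraIdx M, ((uvWeightFn Λ e (matsubaraFreq β M i) * (c * (2 * e / (matsubaraFreq β M i ^ 2 + e ^ 2))) : ℝ) : ℂ) := by
    rw [two_mul]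
    nth_rewrite 2 [hrev]
    rw [← sum_add_distrib]
    exact sum_congr rfl fun i _ => hpair i
  have h2' : ∑ i : MatsubaraIdx M, ((uvWeightFn Λ e (matsubaraFreq β M i) * (c * (2 * e / (matsubaraFreq β M i ^ 2 + e ^ 2))) : ℝ) : ℂ) =
      (2 : ℂ) * ((∑ i : MatsubaraIdx M, uvWeightFn Λ e (matsubaraFreq β M i) * (c * (e / (matsubaraFreq β M i ^ 2 + e ^ 2))) : ℝ) : ℂ) := by
    rw [← Complex.ofReal_sum]
    push_cast
    rw [mul_sum]
    exact sum_congr rfl fun i _ => by ring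
  have h := h2.trans h2'
  exact mul_left_cancel₀ (two_ne_zero) h

/-! ## §2 The scale-`0` tadpole in the currency of the UV Hartree sum -/

variable {L M : ℕ} [NeZero L]

/-- **THE MATSUBARA BRIDGE**: `Σ_k (βL²)⁻²·Ψ⁰(k,σ) = ((L⁻²·Σ_{k⃗} β⁻¹Σᵢ χ₂((ωᵢ²+e_k²)/klE0²)·e_k/(ωᵢ²+e_k²) : ℝ) : ℂ)`, `e_k = ε_L(k⃗) − μ`
(`0 < β`) — the scale-`0` tadpole is `L⁻²` times the UV Hartree sum of `…Theorems.MatsubaraTadpole`, exactly. [cite: BenfattoGiulianiMastropietro2006, §2.1 (2.3)-(2.6)] -/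
theorem scaleZero_tadpole_eq_ofReal_uvTadpoleSum {β : ℝ} (hβ : 0 < β) (μ : ℝ) (σ : Fin 2) :
    ∑ k : FreqMomentum L M, ((1 / (β * (L : ℝ) ^ 2) : ℝ) : ℂ) ^ 2 * uvSymbolCT L M β μ 0 klE0 (k, σ) =
      (((1 / (L : ℝ) ^ 2) * ∑ kv : TorusSite 2 L, β⁻¹ * ∑ i : MatsubaraIdx M,
        salmhoferCutoff ((matsubaraFreq β M i ^ 2 + (torusBand L kv - μ) ^ 2) / klE0 ^ 2) *
          ((torusBand L kv - μ) / (matsubaraFreq β M i ^ 2 + (torusBand L kv - μ) ^ 2)) : ℝ) : ℂ) := by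
  have hL : (0 : ℝ) < (L : ℝ) := by have := NeZero.ne L; positivity
  have hβL : β * (L : ℝ) ^ 2 ≠ 0 := by positivity
  rw [← Finset.mul_sum, Fintype.sum_prod_type, Finset.sum_comm]
  simp_rw [uvSymbolCT_eq_uvSymbolFn hβ μ 0 klE0, nambuXiCT_zero_frame, nambuXi, sum_matsubara_uvSymbolFn_eq_ofReal hβ]
  rw [← Complex.ofReal_sum, ← Complex.ofReal_pow, ← Complex.ofReal_mul, Finset.mul_sum, Finset.mul_sum]
  congr 1
  refine sum_congr rfl fun kv _ => ?_
  rw [Finset.mul_sum, Finset.mul_sum, Finset.mul_sum]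
  refine sum_congr rfl fun i _ => ?_
  simp only [uvWeightFn]
  field_simp

/-- The scale-`0` tadpole has no imaginary part. [cite: BenfattoGiulianiMastropietro2006, §2.1 (2.3)-(2.6)] -/
theorem scaleZero_tadpole_im {β : ℝ} (hβ : 0 < β) (μ : ℝ) (σ : Fin 2) :
    (∑ k : FreqMomentum L M, ((1 / (β * (L : ℝ) ^ 2) : ℝ) : ℂ) ^ 2 * uvSymbolCT L M β μ 0 klE0 (k, σ)).im = 0 := by
  rw [scaleZero_tadpole_eq_ofReal_uvTadpoleSum hβ μ σ, Complex.ofReal_im]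

/-- The real part of the scale-`0` tadpole is `L⁻²` times the UV Hartree sum. [cite: BenfattoGiulianiMastropietro2006, §2.1 (2.3)-(2.6)] -/
theorem scaleZero_tadpole_re {β : ℝ} (hβ : 0 < β) (μ : ℝ) (σ : Fin 2) :
    (∑ k : FreqMomentum L M, ((1 / (β * (L : ℝ) ^ 2) : ℝ) : ℂ) ^ 2 * uvSymbolCT L M β μ 0 klE0 (k, σ)).re =
      (1 / (L : ℝ) ^ 2) * ∑ kv : TorusSite 2 L, β⁻¹ * ∑ i : MatsubaraIdx M,
        salmhoferCutoff ((matsubaraFreq β M i ^ 2 + (torusBand L kv - μ) ^ 2) / klE0 ^ 2) *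
          ((torusBand L kv - μ) / (matsubaraFreq β M i ^ 2 + (torusBand L kv - μ) ^ 2)) := by
  rw [scaleZero_tadpole_eq_ofReal_uvTadpoleSum hβ μ σ, Complex.ofReal_re]

/-- **Monotone transfer**: a lower bound `B` of the UV Hartree sum gives `B/L² ≤ Re t₀`-sum (how `sum_uvTadpole_salmhofer_halfShift_ge` with
`Λ₀ := klE0` feeds the first-order constant of the scale-`0` read). [cite: BenfattoGiulianiMastropietro2006, §2.1 (2.3)-(2.6)] -/
theorem scaleZero_tadpole_re_ge_of_le {β : ℝ} (hβ : 0 < β) (μ : ℝ) (σ : Fin 2) {B : ℝ}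
    (hB : B ≤ ∑ kv : TorusSite 2 L, β⁻¹ * ∑ i : MatsubaraIdx M,
        salmhoferCutoff ((matsubaraFreq β M i ^ 2 + (torusBand L kv - μ) ^ 2) / klE0 ^ 2) *
          ((torusBand L kv - μ) / (matsubaraFreq β M i ^ 2 + (torusBand L kv - μ) ^ 2))) :
    B / (L : ℝ) ^ 2 ≤ (∑ k : FreqMomentum L M, ((1 / (β * (L : ℝ) ^ 2) : ℝ) : ℂ) ^ 2 * uvSymbolCT L M β μ 0 klE0 (k, σ)).re := by
  have hL : (0 : ℝ) < (L : ℝ) ^ 2 := by have := NeZero.ne L; positivity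
  rw [scaleZero_tadpole_re hβ μ σ, one_div_mul_eq_div]
  exact div_le_div_of_nonneg_right hB hL.le

end Summit.HubbardSuperconductivity.HubbardSuperconductivity.Theorems.KLRegimeSplit

end
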